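import Summits.Parity.GeneralizedHardyLittlewood.Theorems.BeyondDiagonalBeatsQuarter.OffDiagLevelAPBridgePsi
import Literature.NumberTheory.Sieve.ParityBarrierLevelProofs
import HarnessLib

/-!
# Route `PrimeLevelFamEdge`, crux K_B (stmt-Parity-20343), line `diagonal_kernel_split` rev 4, plan Ω —
# **the level deviation of a smoothly weighted prime sum over SMALL moduli, at the strength the tree PROVES today**
# (Siegel–Walfisz pointwise; Bombieri–Vinogradov on average; both UNCONDITIONAL)

The two PROVED level-of-distribution theorems of the tree — Siegel–Walfisz
(`Literature.NumberTheory.LFunctions.siegel_walfisz_holds`) and Bombieri–Vinogradov in `π`-form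
(`BombieriVinogradovStatement_holds` ∘ `BombieriVinogradovStatement.primesHaveLevelPi`) — instantiated on the S2
bridges `norm_levelDeviation_primes_mul_log_le_of_psi` (ψ-currency) and `norm_levelDeviation_primes_le_errMax`
(`E_π`-currency) of `OffDiagLevelAPBridgePsi`, as ready kernel bounds for the DEVIATION `levelDeviation` of a
`C¹`-weighted sum over the primes of a block `(N, 2N]` in a residue class:

* **`levelDeviation_primes_siegelWalfisz`** — for every `A > 0` there is `C ≥ 0` such that for all `N ≥ 2`, all moduli
  `1 ≤ n ≤ (log N)^A`, every unit class `a`, and every `g` differentiable on `[N, 2N]` with `‖g′‖ ≤ B` there: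
  `‖levelDeviation (primes of (N,2N]) (g·log) n a‖ ≤ (‖g(2N)‖ + N·B)·(C·N/(log N)^A + 4√(2N)·log(2N))`.
* **`levelDeviation_primes_bombieriVinogradov`** — for every `θ₁ < 1/2` and `A > 0` there is `C` such that for all
  large `N`, every choice of unit classes `a_n` and every such `g`:
  `Σ_{n ≤ (2N)^{θ₁}} ‖levelDeviation (primes of (N,2N]) g n (a_n)‖ ≤ C·(‖g(2N)‖ + N·B)·N/(log N)^A`.

These are LOG-POWER savings over the trivial size: they type what is proved today for the small-moduli (a8S/(S)) level
deviations so that the residual displays of the Ω-blueprint (L9′) can quote a kernel number; the POWER saving the heart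
needs at clean scales is NOT claimed here. Standard axioms; helper toward `stub_offDiagBelowSlack_io`; closes nothing.
«The programme SEARCHES and TYPES; no claim about Landau–Siegel zeros, Theorems 1–2 of arXiv:2211.02515 or
a repaired Margin232 until a kernel theorem says so.»
-/

noncomputable section

open Finset Filter

namespace Summit.Parity.GeneralizedHardyLittlewood.Theorems.BeyondDiagonalBeatsQuarter.OffDiag

open Literature.NumberTheory.Sieve

/-! ### Siegel–Walfisz: pointwise, moduli `n ≤ (log N)^A` -/

/-- **Level deviation over small moduli, Siegel–Walfisz strength (unconditional).** For every `A > 0` there is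
`C ≥ 0` such that for all `N ≥ 2`, `1 ≤ n ≤ (log N)^A`, every unit class `a mod n`, and every weight `g`
differentiable at each point of `[N, 2N]` with `‖g′‖ ≤ B` there:
`‖levelDeviation (primes of (N,2N]) (g·log) n a‖ ≤ (‖g(2N)‖ + N·B)·(C·N/(log N)^A + 4√(2N)·log(2N))`
(`siegel_walfisz_holds` ∘ `norm_levelDeviation_primes_mul_log_le_of_psi`; the `√N log N` term is the prime powers).
[cite: MontgomeryVaughan2007, Corollary 11.19] -/
theorem levelDeviation_primes_siegelWalfisz {A : ℝ} (hA : 0 < A) :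
    ∃ C : ℝ, 0 ≤ C ∧ ∀ N : ℕ, 2 ≤ N → ∀ n : ℕ, 1 ≤ n → (n : ℝ) ≤ Real.log N ^ A →
      ∀ (a : (ZMod n)ˣ) (g : ℝ → ℂ) (B : ℝ),
        (∀ t ∈ Set.Icc (N : ℝ) (2 * N : ℕ), DifferentiableAt ℝ g t) →
        (∀ t ∈ Set.Icc (N : ℝ) (2 * N : ℕ), ‖deriv g t‖ ≤ B) →
          ‖levelDeviation ((Ioc N (2 * N)).filter Nat.Prime) (fun q ↦ g q * ((Real.log q : ℝ) : ℂ)) n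
              (a : ZMod n)‖ ≤
            (‖g (2 * N : ℕ)‖ + (N : ℝ) * B) *
              (C * N / Real.log N ^ A + 4 * Real.sqrt (2 * N : ℕ) * Real.log (2 * N : ℕ)) := by
  obtain ⟨C, hC⟩ := Literature.NumberTheory.LFunctions.siegel_walfisz_holds A hA
  refine ⟨4 * max (2 * C) 0, by positivity, fun N hN n hn hnA a g B hg hB ↦ ?_⟩
  have hN2 : (2 : ℝ) ≤ N := by exact_mod_cast hN
  have hlogN : 0 < Real.log N := Real.log_pos (by linarith)
  have hLA : 0 < Real.log N ^ A := Real.rpow_pos_of_pos hlogN A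
  have hNN : N ≤ 2 * N := by omega
  -- the Siegel–Walfisz bound on `[N, 2N]`, uniformly: `E = max(2C,0)·N/(log N)^A`
  set E : ℝ := max (2 * C) 0 * N / Real.log N ^ A with hE
  have hψ : ∀ u : (ZMod n)ˣ, ∀ y : ℕ, N ≤ y → y ≤ 2 * N →
      |LevelOfDistribution.chebyshevPsiMod n (u : ZMod n) y - (y : ℝ) / Nat.totient n| ≤ E := by
    intro u y hy1 hy2
    have hy2' : (2 : ℝ) ≤ y := le_trans hN2 (by exact_mod_cast hy1)
    have hlogy : Real.log N ≤ Real.log y := Real.log_le_log (by linarith) (by exact_mod_cast hy1)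
    have hlogyA : Real.log N ^ A ≤ Real.log y ^ A := Real.rpow_le_rpow hlogN.le hlogy hA.le
    have hq : (n : ℝ) ≤ Real.log y ^ A := hnA.trans hlogyA
    have h := hC y hy2' n hn hq u
    rw [← chebyshevPsiMod_eq_wave0]
    refine h.trans ?_
    have hyA : 0 < Real.log y ^ A := lt_of_lt_of_le hLA hlogyA
    have hy2N : (y : ℝ) ≤ 2 * N := by exact_mod_cast hy2
    calc C * y / Real.log y ^ A ≤ max (2 * C) 0 / 2 * y / Real.log y ^ A := by
          have : C ≤ max (2 * C) 0 / 2 := by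
            have := le_max_left (2 * C) 0; linarith
          gcongr
      _ ≤ max (2 * C) 0 / 2 * (2 * N) / Real.log N ^ A := by
          have h0 : 0 ≤ max (2 * C) 0 / 2 := by positivity
          calc max (2 * C) 0 / 2 * y / Real.log y ^ A ≤ max (2 * C) 0 / 2 * (2 * N) / Real.log y ^ A := by
                gcongr
            _ ≤ max (2 * C) 0 / 2 * (2 * N) / Real.log N ^ A := by
                apply div_le_div_of_nonneg_left _ hLA hlogyA
                positivity
      _ = E := by rw [hE]; ring
  have h := norm_levelDeviation_primes_mul_log_le_of_psi hn a (by omega : 1 ≤ N) hNN hg hB hψ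
  refine h.trans (le_of_eq ?_)
  have : ((2 * N : ℕ) : ℝ) - N = N := by push_cast; ring
  rw [this, hE]
  ring

/-! ### Bombieri–Vinogradov: on average over moduli `n ≤ (2N)^{θ₁}`, `θ₁ < 1/2` -/

/-- **Level deviation on average over moduli, Bombieri–Vinogradov strength (unconditional).** For every `θ₁ < 1/2`
and `A > 0` there is `C` such that for all large `N`, every choice of unit classes `a_n` (one per modulus), and every
weight `g` differentiable at each point of `[N, 2N]` with `‖g′‖ ≤ B` there:
`Σ_{1 ≤ n ≤ (2N)^{θ₁}} ‖levelDeviation (primes of (N,2N]) g n (a_n)‖ ≤ C·(‖g(2N)‖ + N·B)·N/(log N)^A`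
(`BombieriVinogradovStatement_holds` in `π`-form, `primesHaveLevelPi_iff_errMax`, ∘ `norm_levelDeviation_primes_le_errMax`).
[cite: IwaniecKowalski2004, Theorem 17.1] -/
theorem levelDeviation_primes_bombieriVinogradov {θ₁ : ℝ} (hθ₁ : θ₁ < 1 / 2) {A : ℝ} (hA : 0 < A) :
    ∃ C : ℝ, ∀ᶠ N : ℕ in atTop, ∀ (a : (n : ℕ) → (ZMod n)ˣ) (g : ℝ → ℂ) (B : ℝ),
      (∀ t ∈ Set.Icc (N : ℝ) (2 * N : ℕ), DifferentiableAt ℝ g t) →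
      (∀ t ∈ Set.Icc (N : ℝ) (2 * N : ℕ), ‖deriv g t‖ ≤ B) →
        ∑ n ∈ Icc 1 ⌊((2 * N : ℕ) : ℝ) ^ θ₁⌋₊,
            ‖levelDeviation ((Ioc N (2 * N)).filter Nat.Prime) (fun q ↦ g q) n (a n : ZMod n)‖ ≤
          C * (‖g (2 * N : ℕ)‖ + (N : ℝ) * B) * N / Real.log N ^ A := by
  set θ := (θ₁ + 1 / 2) / 2 with hθ
  have hθlt : θ < 1 / 2 := by rw [hθ]; linarith
  have hε : 0 < θ - θ₁ := by rw [hθ]; linarith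
  have hPi := BombieriVinogradovStatement_holds.primesHaveLevelPi hθlt
  have hO := (primesHaveLevelPi_iff_errMax.mp hPi) A hA (θ - θ₁) hε
  rw [show θ - (θ - θ₁) = θ₁ by ring] at hO
  obtain ⟨C, hC⟩ := hO.bound
  obtain ⟨x₀, hx₀⟩ := Filter.eventually_atTop.mp hC
  -- constant: `Σ_n E_π(2N; n) ≤ C·2N/(log 2N)^A ≤ C·2N/(log N)^A` for `N ≥ 2`, times `4`
  refine ⟨8 * max C 0, ?_⟩
  rw [Filter.eventually_atTop]
  refine ⟨max ⌈x₀⌉₊ 2, fun N hN a g B hg hB ↦ ?_⟩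
  have hN2 : 2 ≤ N := le_trans (le_max_right _ _) hN
  have hNx : x₀ ≤ ((2 * N : ℕ) : ℝ) := by
    have h1 : x₀ ≤ ⌈x₀⌉₊ := Nat.le_ceil _
    have h2 : (⌈x₀⌉₊ : ℝ) ≤ N := by exact_mod_cast le_trans (le_max_left _ _) hN
    have h3 : (N : ℝ) ≤ ((2 * N : ℕ) : ℝ) := by exact_mod_cast (by omega : N ≤ 2 * N)
    linarith
  have hN2r : (2 : ℝ) ≤ N := by exact_mod_cast hN2
  have h2N1 : (1 : ℝ) < ((2 * N : ℕ) : ℝ) := by push_cast; linarith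
  have hlogN : 0 < Real.log N := Real.log_pos (by linarith)
  have hlog2N : 0 < Real.log ((2 * N : ℕ) : ℝ) := Real.log_pos h2N1
  have hLA : 0 < Real.log N ^ A := Real.rpow_pos_of_pos hlogN A
  have hL2A : 0 < Real.log ((2 * N : ℕ) : ℝ) ^ A := Real.rpow_pos_of_pos hlog2N A
  -- the `E_π` sum at `x = 2N`
  have hsum : ∑ n ∈ Icc 1 ⌊((2 * N : ℕ) : ℝ) ^ θ₁⌋₊, primeCountingAPErrMax ((2 * N : ℕ) : ℝ) n ≤
      max C 0 * (((2 * N : ℕ) : ℝ) / Real.log ((2 * N : ℕ) : ℝ) ^ A) := by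
    have h := hx₀ _ hNx
    rw [Real.norm_of_nonneg (Finset.sum_nonneg fun n _ ↦ primeCountingAPErrMax_nonneg _ _),
      Real.norm_of_nonneg (by positivity)] at h
    exact h.trans (mul_le_mul_of_nonneg_right (le_max_left _ _) (by positivity))
  -- each deviation through the `E_π`-bridge
  have hB0 : 0 ≤ B := (norm_nonneg _).trans (hB N ⟨le_rfl, by exact_mod_cast (by omega : N ≤ 2 * N)⟩)
  have hW0 : 0 ≤ ‖g (2 * N : ℕ)‖ + (N : ℝ) * B := by positivity
  have hdev : ∀ n ∈ Icc 1 ⌊((2 * N : ℕ) : ℝ) ^ θ₁⌋₊,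
      ‖levelDeviation ((Ioc N (2 * N)).filter Nat.Prime) (fun q ↦ g q) n (a n : ZMod n)‖ ≤
        4 * primeCountingAPErrMax ((2 * N : ℕ) : ℝ) n * (‖g (2 * N : ℕ)‖ + (N : ℝ) * B) := by
    intro n hn
    have hn1 : 1 ≤ n := (Finset.mem_Icc.mp hn).1
    have h := norm_levelDeviation_primes_le_errMax hn1 (a n) (by omega : 1 ≤ N) (by omega : N ≤ 2 * N) hg hB
    have : ((2 * N : ℕ) : ℝ) - N = N := by push_cast; ring
    rwa [this] at h
  calc ∑ n ∈ Icc 1 ⌊((2 * N : ℕ) : ℝ) ^ θ₁⌋₊,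
        ‖levelDeviation ((Ioc N (2 * N)).filter Nat.Prime) (fun q ↦ g q) n (a n : ZMod n)‖
      ≤ ∑ n ∈ Icc 1 ⌊((2 * N : ℕ) : ℝ) ^ θ₁⌋₊,
          4 * primeCountingAPErrMax ((2 * N : ℕ) : ℝ) n * (‖g (2 * N : ℕ)‖ + (N : ℝ) * B) :=
        Finset.sum_le_sum hdev
    _ = 4 * (‖g (2 * N : ℕ)‖ + (N : ℝ) * B) *
          ∑ n ∈ Icc 1 ⌊((2 * N : ℕ) : ℝ) ^ θ₁⌋₊, primeCountingAPErrMax ((2 * N : ℕ) : ℝ) n := by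
        rw [Finset.mul_sum]
        exact Finset.sum_congr rfl fun n _ ↦ by ring
    _ ≤ 4 * (‖g (2 * N : ℕ)‖ + (N : ℝ) * B) * (max C 0 * (((2 * N : ℕ) : ℝ) / Real.log ((2 * N : ℕ) : ℝ) ^ A)) :=
        mul_le_mul_of_nonneg_left hsum (by positivity)
    _ ≤ 4 * (‖g (2 * N : ℕ)‖ + (N : ℝ) * B) * (max C 0 * ((2 * N : ℝ) / Real.log N ^ A)) := by
        have hlog : Real.log N ≤ Real.log ((2 * N : ℕ) : ℝ) :=
          Real.log_le_log (by linarith) (by push_cast; linarith)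
        have hpow : Real.log N ^ A ≤ Real.log ((2 * N : ℕ) : ℝ) ^ A := Real.rpow_le_rpow hlogN.le hlog hA.le
        have h2 : ((2 * N : ℕ) : ℝ) / Real.log ((2 * N : ℕ) : ℝ) ^ A ≤ (2 * N : ℝ) / Real.log N ^ A := by
          have hcast : ((2 * N : ℕ) : ℝ) = 2 * N := by push_cast; ring
          rw [hcast] at hpow ⊢
          exact div_le_div_of_nonneg_left (by positivity) hLA hpow
        gcongr
    _ = 8 * max C 0 * (‖g (2 * N : ℕ)‖ + (N : ℝ) * B) * N / Real.log N ^ A := by ring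

/-! ### Plain weights: `F = (F/log)·log` on the primes of the block -/

/-- `levelDeviation Q F n a` depends only on the values of `F` on `Q`. [folklore] -/
theorem levelDeviation_congr {Q : Finset ℕ} {F F' : ℕ → ℂ} (h : ∀ q ∈ Q, F q = F' q) (n : ℕ) (a : ZMod n) :
    levelDeviation Q F n a = levelDeviation Q F' n a := by
  classical
  simp only [levelDeviation, levelPrincipal, levelAPSum, levelCoprimeSum]
  rw [Finset.sum_congr rfl fun q hq ↦ h q (Finset.mem_filter.mp hq).1,
    Finset.sum_congr rfl fun q hq ↦ h q (Finset.mem_filter.mp hq).1]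

/-- **The quotient weight `F/log` on `[N, 2N]`** (`N ≥ 2`): if `F` is differentiable at every point of `[N, 2N]` with
`‖F‖ ≤ A₀` and `‖F′‖ ≤ A₁` there, then `g = F/log` is differentiable there with
`‖g′‖ ≤ A₁/log N + A₀/(N·(log N)²)` and `‖g(2N)‖ ≤ A₀/log N`. [folklore] -/
theorem deriv_div_log_bound {N : ℕ} (hN : 2 ≤ N) {F : ℝ → ℂ} {A₀ A₁ : ℝ}
    (hF : ∀ t ∈ Set.Icc (N : ℝ) (2 * N : ℕ), DifferentiableAt ℝ F t)
    (hA₀ : ∀ t ∈ Set.Icc (N : ℝ) (2 * N : ℕ), ‖F t‖ ≤ A₀)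
    (hA₁ : ∀ t ∈ Set.Icc (N : ℝ) (2 * N : ℕ), ‖deriv F t‖ ≤ A₁) :
    (∀ t ∈ Set.Icc (N : ℝ) (2 * N : ℕ), DifferentiableAt ℝ (fun t ↦ F t / ((Real.log t : ℝ) : ℂ)) t) ∧
    (∀ t ∈ Set.Icc (N : ℝ) (2 * N : ℕ),
      ‖deriv (fun t ↦ F t / ((Real.log t : ℝ) : ℂ)) t‖ ≤ A₁ / Real.log N + A₀ / (N * Real.log N ^ 2)) ∧
    ‖F (2 * N : ℕ) / ((Real.log ((2 * N : ℕ) : ℝ) : ℝ) : ℂ)‖ ≤ A₀ / Real.log N := by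
  have hN2 : (2 : ℝ) ≤ N := by exact_mod_cast hN
  have hlogN : 0 < Real.log N := Real.log_pos (by linarith)
  have h2N : (N : ℝ) ≤ ((2 * N : ℕ) : ℝ) := by exact_mod_cast (by omega : N ≤ 2 * N)
  -- derivative of `F/log` at a point `t ≥ N`
  have key : ∀ t ∈ Set.Icc (N : ℝ) (2 * N : ℕ),
      HasDerivAt (fun t ↦ F t / ((Real.log t : ℝ) : ℂ))
        ((deriv F t * ((Real.log t : ℝ) : ℂ) - F t * ((t⁻¹ : ℝ) : ℂ)) / ((Real.log t : ℝ) : ℂ) ^ 2) t ∧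
      Real.log N ≤ Real.log t ∧ (N : ℝ) ≤ t := by
    intro t ht
    have htN : (N : ℝ) ≤ t := ht.1
    have ht0 : 0 < t := by linarith
    have hlogt : Real.log N ≤ Real.log t := Real.log_le_log (by linarith) htN
    have hlog0 : ((Real.log t : ℝ) : ℂ) ≠ 0 := by
      have : 0 < Real.log t := lt_of_lt_of_le hlogN hlogt
      exact_mod_cast this.ne'
    have hL : HasDerivAt (fun y : ℝ ↦ ((Real.log y : ℝ) : ℂ)) ((t⁻¹ : ℝ) : ℂ) t :=
      (Real.hasDerivAt_log ht0.ne').ofReal_comp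
    exact ⟨(hF t ht).hasDerivAt.div hL hlog0, hlogt, htN⟩
  refine ⟨fun t ht ↦ (key t ht).1.differentiableAt, fun t ht ↦ ?_, ?_⟩
  · obtain ⟨hd, hlogt, htN⟩ := key t ht
    have ht0 : 0 < t := by linarith
    have hlt : 0 < Real.log t := lt_of_lt_of_le hlogN hlogt
    rw [hd.deriv, norm_div, norm_pow, Complex.norm_real, Real.norm_of_nonneg hlt.le]
    have h1 : ‖deriv F t * ((Real.log t : ℝ) : ℂ) - F t * ((t⁻¹ : ℝ) : ℂ)‖ ≤ A₁ * Real.log t + A₀ * t⁻¹ := by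
      refine (norm_sub_le _ _).trans (add_le_add ?_ ?_)
      · rw [norm_mul, Complex.norm_real, Real.norm_of_nonneg hlt.le]
        exact mul_le_mul_of_nonneg_right (hA₁ t ht) hlt.le
      · rw [norm_mul, Complex.norm_real, Real.norm_of_nonneg (inv_nonneg.mpr ht0.le)]
        exact mul_le_mul_of_nonneg_right (hA₀ t ht) (inv_nonneg.mpr ht0.le)
    have hA₀0 : 0 ≤ A₀ := (norm_nonneg _).trans (hA₀ t ht)
    have hA₁0 : 0 ≤ A₁ := (norm_nonneg _).trans (hA₁ t ht)
    calc ‖deriv F t * ((Real.log t : ℝ) : ℂ) - F t * ((t⁻¹ : ℝ) : ℂ)‖ / Real.log t ^ 2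
        ≤ (A₁ * Real.log t + A₀ * t⁻¹) / Real.log t ^ 2 := div_le_div_of_nonneg_right h1 (by positivity)
      _ = A₁ / Real.log t + A₀ / (t * Real.log t ^ 2) := by field_simp
      _ ≤ A₁ / Real.log N + A₀ / (N * Real.log N ^ 2) := by
          have hN0 : (0 : ℝ) < N := by linarith
          gcongr
  · have ht : ((2 * N : ℕ) : ℝ) ∈ Set.Icc (N : ℝ) (2 * N : ℕ) := ⟨h2N, le_rfl⟩
    have hlog2 : Real.log N ≤ Real.log ((2 * N : ℕ) : ℝ) := Real.log_le_log (by linarith) h2N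
    have hl2 : 0 < Real.log ((2 * N : ℕ) : ℝ) := lt_of_lt_of_le hlogN hlog2
    rw [norm_div, Complex.norm_real, Real.norm_of_nonneg hl2.le]
    have hA₀0 : 0 ≤ A₀ := (norm_nonneg _).trans (hA₀ _ ht)
    calc ‖F (2 * N : ℕ)‖ / Real.log ((2 * N : ℕ) : ℝ) ≤ A₀ / Real.log ((2 * N : ℕ) : ℝ) :=
          div_le_div_of_nonneg_right (hA₀ _ ht) hl2.le
      _ ≤ A₀ / Real.log N := div_le_div_of_nonneg_left hA₀0 hlogN hlog2

/-- **Level deviation over small moduli for a PLAIN `C¹` weight, Siegel–Walfisz strength (unconditional).** For every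
`A > 0` there is `C ≥ 0` such that for all `N ≥ 2`, `1 ≤ n ≤ (log N)^A`, every unit class `a mod n`, and every `F`
differentiable at each point of `[N, 2N]` with `‖F‖ ≤ A₀`, `‖F′‖ ≤ A₁` there:
`‖levelDeviation (primes of (N,2N]) F n a‖ ≤ (A₀/log N + N·(A₁/log N + A₀/(N (log N)²)))·(C·N/(log N)^A + 4√(2N)·log(2N))`
(`levelDeviation_primes_siegelWalfisz` for `g = F/log`, `F = g·log` on the primes of the block). [folklore] -/
theorem levelDeviation_primes_siegelWalfisz_plain {A : ℝ} (hA : 0 < A) :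
    ∃ C : ℝ, 0 ≤ C ∧ ∀ N : ℕ, 2 ≤ N → ∀ n : ℕ, 1 ≤ n → (n : ℝ) ≤ Real.log N ^ A →
      ∀ (a : (ZMod n)ˣ) (F : ℝ → ℂ) (A₀ A₁ : ℝ),
        (∀ t ∈ Set.Icc (N : ℝ) (2 * N : ℕ), DifferentiableAt ℝ F t) →
        (∀ t ∈ Set.Icc (N : ℝ) (2 * N : ℕ), ‖F t‖ ≤ A₀) →
        (∀ t ∈ Set.Icc (N : ℝ) (2 * N : ℕ), ‖deriv F t‖ ≤ A₁) →
          ‖levelDeviation ((Ioc N (2 * N)).filter Nat.Prime) (fun q ↦ F q) n (a : ZMod n)‖ ≤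
            (A₀ / Real.log N + (N : ℝ) * (A₁ / Real.log N + A₀ / (N * Real.log N ^ 2))) *
              (C * N / Real.log N ^ A + 4 * Real.sqrt (2 * N : ℕ) * Real.log (2 * N : ℕ)) := by
  obtain ⟨C, hC0, hC⟩ := levelDeviation_primes_siegelWalfisz hA
  refine ⟨C, hC0, fun N hN n hn hnA a F A₀ A₁ hF hA₀ hA₁ ↦ ?_⟩
  obtain ⟨hg, hg', hg2N⟩ := deriv_div_log_bound hN hF hA₀ hA₁
  have h := hC N hN n hn hnA a (fun t ↦ F t / ((Real.log t : ℝ) : ℂ)) _ hg hg'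
  -- `F = (F/log)·log` on the primes of the block (`q > N ≥ 2`, so `log q ≠ 0`)
  have hcongr : levelDeviation ((Ioc N (2 * N)).filter Nat.Prime) (fun q ↦ F q) n (a : ZMod n) =
      levelDeviation ((Ioc N (2 * N)).filter Nat.Prime)
        (fun q ↦ F q / ((Real.log q : ℝ) : ℂ) * ((Real.log q : ℝ) : ℂ)) n (a : ZMod n) := by
    refine levelDeviation_congr (fun q hq ↦ ?_) n (a : ZMod n)
    have hq2 : (2 : ℝ) ≤ q := by
      have := (Finset.mem_Ioc.mp (Finset.mem_filter.mp hq).1).1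
      exact_mod_cast le_trans hN this.le
    have hlog : ((Real.log q : ℝ) : ℂ) ≠ 0 := by exact_mod_cast (Real.log_pos (by linarith)).ne'
    rw [div_mul_cancel₀ _ hlog]
  rw [hcongr]
  refine h.trans ?_
  have hN2 : (2 : ℝ) ≤ N := by exact_mod_cast hN
  have hlogN : 0 < Real.log N := Real.log_pos (by linarith)
  have h4 : 0 ≤ C * N / Real.log N ^ A + 4 * Real.sqrt (2 * N : ℕ) * Real.log (2 * N : ℕ) := by
    have : 0 ≤ Real.log ((2 * N : ℕ) : ℝ) := Real.log_nonneg (by push_cast; linarith)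
    have : 0 < Real.log N ^ A := Real.rpow_pos_of_pos hlogN A
    positivity
  have hB0 : 0 ≤ A₁ / Real.log N + A₀ / (N * Real.log N ^ 2) :=
    (norm_nonneg _).trans (hg' N ⟨le_rfl, by exact_mod_cast (by omega : N ≤ 2 * N)⟩)
  gcongr

end Summit.Parity.GeneralizedHardyLittlewood.Theorems.BeyondDiagonalBeatsQuarter.OffDiag
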